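import Literature.NumberTheory.QuadraticForms.HasseMinkowski
import Mathlib.LinearAlgebra.QuadraticForm.Basic
import Mathlib.LinearAlgebra.Matrix.Nondegenerate
import Mathlib.LinearAlgebra.BilinearForm.Orthogonal
import Mathlib.Data.Finset.Sort
import HarnessLib

/-!
# Hasse–Minkowski and Meyer: reduction to diagonal forms

Topic `NumberTheory/QuadraticForms`; namespace `Literature.NumberTheory.QuadraticForms`. Everything
here is proved; linear algebra only.

Serre, *A Course in Arithmetic*, proves the Hasse–Minkowski theorem (Ch. IV §3.2 Thm 8) and
Meyer's theorem (Cor. 2) for forms written `f = a₁X₁² + … + aₙXₙ²` ("we write `f` in the form …",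
PDF p. 39), every quadratic form over a field of characteristic `≠ 2` being equivalent to a
diagonal one (Ch. IV §1.4). The named facts `hasseMinkowski` and `meyer` (`HasseMinkowski.lean`,
`Meyer.lean`) are stated for arbitrary symmetric matrices; this file reduces them to diagonal
statements, so that a proof for diagonal forms — over Mathlib's `ℚ_[p]`, or at the places of `ℚ`
— discharges them:

* `exists_congr_diagonal` — for a symmetric `A ∈ Mₙ(ℚ)` there are an invertible `P` and `c` with
  `ᵗP A P = diag(c)` (an orthogonal basis, Mathlib `LinearMap.BilinForm.exists_orthogonal_basis`),
  and `cᵢ ≠ 0` when `det A ≠ 0`;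
* `representsZero_of_congr`, `representsZero_congr`, `exists_diag_zero_of_representsZero_map` —
  representing zero is invariant under `A ↦ ᵗP A P` and compatible with base change along a
  ring homomorphism `φ : ℚ → K`: a zero of `A` over `K` gives a zero `∑ φ(cᵢ) uᵢ² = 0` of the
  diagonal form;
* `hasseMinkowski_of_diagonal` — **Thm 8 for diagonal forms implies `hasseMinkowski`**: if for
  every `n` and all `cᵢ ∈ ℚ^*` a real zero and a zero in every `ℚ_p` of `∑ cᵢXᵢ²` give a rational
  zero, then `hasseMinkowski` holds;
* `meyer_of_diagonal` — **Cor. 2 for diagonal forms of rank `5` implies `meyer`**: if every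
  `∑_{i<5} cᵢXᵢ²` with `cᵢ ∈ ℚ^*` of both signs has a rational zero, then `meyer` holds (for a
  form of rank `≥ 5` taking both signs, an orthogonal basis has squares of both signs; keep five of
  them including one of each sign);
* `representsZero_iff_not_anisotropic` — dictionary with Mathlib's `QuadraticMap.Anisotropic`
  (requested at the review of `HasseMinkowski.lean`).

## References

* J.-P. Serre, *A Course in Arithmetic*, GTM 7, Springer 1973, Ch. IV §1.4 (orthogonal bases),
  §3.2 Thm 8 and Cor. 2 (PDF pp. 29, 39–41). [Serre1973]
-/

namespace Literature.NumberTheory.QuadraticForms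

open Matrix Finset

/-! ### Representing zero under congruence and base change -/

section Congr

variable {R : Type*} [CommRing R] {n : ℕ}

/-- `ᵗ(P x) M (P y) = ᵗx (ᵗP M P) y`. [folklore] -/
theorem toBilin'_mulVec_mulVec (M P : Matrix (Fin n) (Fin n) R) (x y : Fin n → R) :
    Matrix.toBilin' M (P *ᵥ x) (P *ᵥ y) = Matrix.toBilin' (Pᵀ * M * P) x y := by
  rw [Matrix.toBilin'_apply', Matrix.toBilin'_apply', ← Matrix.vecMul_transpose P x,
    ← Matrix.dotProduct_mulVec x Pᵀ, Matrix.mulVec_mulVec, Matrix.mulVec_mulVec]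

/-- The diagonal form: `ᵗx diag(c) x = ∑ cᵢ xᵢ²`. [folklore] -/
theorem toBilin'_diagonal_apply (c x : Fin n → R) :
    Matrix.toBilin' (Matrix.diagonal c) x x = ∑ i, c i * x i ^ 2 := by
  simp only [Matrix.toBilin'_apply', dotProduct, Matrix.mulVec_diagonal]
  exact Finset.sum_congr rfl fun i _ => by ring

/-- **Congruent matrices represent zero together**: if `P` is invertible and `ᵗx (ᵗP A P) x = 0`
with `x ≠ 0` then `P x ≠ 0` is a zero of `A`. [folklore] -/
theorem representsZero_of_congr {A P Q : Matrix (Fin n) (Fin n) R} (hQP : Q * P = 1)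
    (h : RepresentsZero (Pᵀ * A * P)) : RepresentsZero A := by
  obtain ⟨x, hx0, hx⟩ := h
  refine ⟨P *ᵥ x, fun h0 => hx0 ?_, by rw [toBilin'_mulVec_mulVec, hx]⟩
  have := congrArg (Q *ᵥ ·) h0
  simpa [Matrix.mulVec_mulVec, hQP] using this

/-- Conversely a zero of `A` gives a zero of `ᵗP A P` (apply the previous lemma to `P⁻¹`).
[folklore] -/
theorem representsZero_congr {A P Q : Matrix (Fin n) (Fin n) R} (hPQ : P * Q = 1)
    (h : RepresentsZero A) : RepresentsZero (Pᵀ * A * P) := by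
  refine representsZero_of_congr (P := Q) (Q := P) hPQ ?_
  have : Qᵀ * (Pᵀ * A * P) * Q = A := by
    calc Qᵀ * (Pᵀ * A * P) * Q = (P * Q)ᵀ * A * (P * Q) := by
          rw [Matrix.transpose_mul]; simp only [Matrix.mul_assoc]
      _ = A := by rw [hPQ, Matrix.transpose_one, Matrix.one_mul, Matrix.mul_one]
  rwa [this]

variable {S : Type*} [CommRing S]

/-- **Base change and congruence**: if `ᵗP A P = diag(c)` over `R` with `P` invertible and
`φ : R → S` is a ring homomorphism, a zero of `φ(A)` over `S` gives a zero of the diagonal form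
`∑ φ(cᵢ) Xᵢ²` over `S`. [folklore] -/
theorem exists_diag_zero_of_representsZero_map (φ : R →+* S) {A P Q : Matrix (Fin n) (Fin n) R}
    {c : Fin n → R} (hPQ : P * Q = 1) (hD : Pᵀ * A * P = Matrix.diagonal c)
    (h : RepresentsZero (A.map φ)) : ∃ u : Fin n → S, u ≠ 0 ∧ ∑ i, φ (c i) * u i ^ 2 = 0 := by
  have hPQ' : P.map φ * Q.map φ = 1 := by
    rw [← Matrix.map_mul, hPQ, Matrix.map_one _ φ.map_zero φ.map_one]
  obtain ⟨u, hu0, hu⟩ := representsZero_congr hPQ' h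
  refine ⟨u, hu0, ?_⟩
  have hD' : (P.map φ)ᵀ * A.map φ * P.map φ = Matrix.diagonal (φ ∘ c) := by
    rw [← Matrix.transpose_map, ← Matrix.map_mul, ← Matrix.map_mul, hD, Matrix.diagonal_map φ.map_zero]
    rfl
  rwa [hD', toBilin'_diagonal_apply] at hu

end Congr

/-! ### Diagonalisation over `ℚ` -/

/-- **Every symmetric rational matrix is congruent to a diagonal one** (Serre, Ch. IV §1.4: every
quadratic module has an orthogonal basis; Mathlib `LinearMap.BilinForm.exists_orthogonal_basis`):
`ᵗP A P = diag(c)` with `P` invertible, `P x = ∑ xᵢ bᵢ` for the orthogonal basis `b`; if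
`det A ≠ 0` all `cᵢ = bᵢ.bᵢ` are non-zero. Stated over any field of characteristic `≠ 2`.
[cite: Serre1973, Ch. IV §1.4] -/
theorem exists_congr_diagonal {K : Type*} [Field K] [NeZero (2 : K)] {n : ℕ}
    (A : Matrix (Fin n) (Fin n) K) (hA : A.IsSymm) :
    ∃ (P Q : Matrix (Fin n) (Fin n) K) (c : Fin n → K), P * Q = 1 ∧ Q * P = 1 ∧
      Pᵀ * A * P = Matrix.diagonal c ∧ (A.det ≠ 0 → ∀ i, c i ≠ 0) := by
  classical
  set B := Matrix.toBilin' A with hB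
  have hBs : B.IsSymm := Matrix.isSymm_toBilin'_iff_isSymm.mpr hA
  haveI : Invertible (2 : K) := invertibleOfNonzero (NeZero.ne 2)
  obtain ⟨b₀, hb₀⟩ := LinearMap.BilinForm.exists_orthogonal_basis
    (LinearMap.BilinForm.isSymm_iff.mp hBs)
  -- reindex to `Fin n`
  have hN : Module.finrank K (Fin n → K) = n := Module.finrank_fin_fun K
  let b : Module.Basis (Fin n) K (Fin n → K) := b₀.reindex (finCongr hN)
  have hb : LinearMap.BilinForm.iIsOrtho B b := by
    rw [LinearMap.BilinForm.iIsOrtho_def]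
    intro i j hij
    have h0 : B (b₀ ((finCongr hN).symm i)) (b₀ ((finCongr hN).symm j)) = 0 :=
      hb₀ (fun h => hij (by simpa using congrArg (finCongr hN) h))
    simpa [b] using h0
  -- `P` = matrix of `b` in the standard basis
  set P : Matrix (Fin n) (Fin n) K := (Pi.basisFun K (Fin n)).toMatrix b with hP
  set Q : Matrix (Fin n) (Fin n) K := b.toMatrix (Pi.basisFun K (Fin n)) with hQ
  refine ⟨P, Q, fun i => B (b i) (b i), Module.Basis.toMatrix_mul_toMatrix_flip _ _,
    Module.Basis.toMatrix_mul_toMatrix_flip _ _, ?_, fun hdet i => ?_⟩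
  · -- `ᵗP A P = (B (b i) (b j))`, diagonal by orthogonality
    have h1 : Pᵀ * A * P = LinearMap.BilinForm.toMatrix b B := by
      rw [hP, ← LinearMap.BilinForm.toMatrix_mul_basis_toMatrix (Pi.basisFun K (Fin n)) b B,
        LinearMap.BilinForm.toMatrix_basisFun, hB, LinearMap.BilinForm.toMatrix'_toBilin']
    rw [h1]
    ext i j
    rw [LinearMap.BilinForm.toMatrix_apply, Matrix.diagonal_apply]
    split_ifs with hij
    · rw [hij]
    · exact LinearMap.BilinForm.iIsOrtho_def.mp hb i j hij
  · exact hb.not_isOrtho_basis_self_of_nondegenerate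
      (LinearMap.BilinForm.nondegenerate_toBilin'_of_det_ne_zero' A hdet) i

/-! ### Hasse–Minkowski from the diagonal case -/

/-- **Hasse–Minkowski for diagonal forms implies `hasseMinkowski`.** Suppose that for every `n`
and every `c : Fin n → ℚ` with all `cᵢ ≠ 0`, the existence of a non-trivial real zero and of a
non-trivial zero in each `ℚ_p` of `∑ cᵢ Xᵢ²` implies that of a rational zero (Serre, Ch. IV §3.2
Thm 8 as proved there, for `f = a₁X₁² + … + aₙXₙ²`). Then the named fact `hasseMinkowski`
(arbitrary nondegenerate symmetric matrices) holds: diagonalise over `ℚ` (`exists_congr_diagonal`)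
and transport the local zeros (`exists_diag_zero_of_representsZero_map`).
[cite: Serre1973, Ch. IV §3.2 Thm 8] -/
theorem hasseMinkowski_of_diagonal
    (h : ∀ (n : ℕ) (c : Fin n → ℚ), (∀ i, c i ≠ 0) →
      (∃ x : Fin n → ℝ, x ≠ 0 ∧ ∑ i, (c i : ℝ) * x i ^ 2 = 0) →
      (∀ (p : ℕ) [Fact p.Prime], ∃ x : Fin n → ℚ_[p], x ≠ 0 ∧ ∑ i, (c i : ℚ_[p]) * x i ^ 2 = 0) →
      ∃ x : Fin n → ℚ, x ≠ 0 ∧ ∑ i, c i * x i ^ 2 = 0) :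
    hasseMinkowski := by
  intro n A hA hdet hR hP
  obtain ⟨P, Q, c, hPQ, hQP, hD, hc⟩ := exists_congr_diagonal A hA
  have hreal := exists_diag_zero_of_representsZero_map (Rat.castHom ℝ) hPQ hD hR
  simp only [Rat.coe_castHom] at hreal
  have hpadic : ∀ (p : ℕ) [Fact p.Prime],
      ∃ x : Fin n → ℚ_[p], x ≠ 0 ∧ ∑ i, (c i : ℚ_[p]) * x i ^ 2 = 0 := by
    intro p _
    have := exists_diag_zero_of_representsZero_map (Rat.castHom ℚ_[p]) hPQ hD (hP p)
    simpa only [Rat.coe_castHom] using this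
  obtain ⟨x, hx0, hx⟩ := h n c (hc hdet) hreal hpadic
  refine representsZero_of_congr hQP ⟨x, hx0, ?_⟩
  rw [hD, toBilin'_diagonal_apply, hx]

/-! ### Meyer from the diagonal case -/

/-- A diagonal form `∑ cᵢ xᵢ²` with all `cᵢ ≤ 0` takes no positive value, and with all `cᵢ ≥ 0`
no negative value; so a form taking both signs has coefficients of both signs in any orthogonal
basis. [folklore] -/
theorem exists_neg_of_sum_mul_sq_neg {n : ℕ} {c x : Fin n → ℚ} (h : ∑ i, c i * x i ^ 2 < 0) :
    ∃ i, c i < 0 := by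
  by_contra hc
  push Not at hc
  have : 0 ≤ ∑ i, c i * x i ^ 2 := Finset.sum_nonneg fun i _ => mul_nonneg (hc i) (sq_nonneg _)
  linarith

/-- **Meyer's theorem for diagonal forms of rank `5` implies `meyer`.** Suppose every
`∑_{i<5} cᵢ Xᵢ²` with `cᵢ ∈ ℚ^*` not all of the same sign has a non-trivial rational zero (Serre,
Ch. IV §3.2 Cor. 2 for `f = a₁X₁² + … + a₅X₅²`). Then `meyer` holds: for a nondegenerate symmetric
`A ∈ Mₙ(ℚ)`, `n ≥ 5`, taking both signs, an orthogonal basis `b` has squares `cᵢ = bᵢ.bᵢ` of both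
signs (`exists_neg_of_sum_mul_sq_neg`); choose five indices containing one of each sign and a zero
of the corresponding rank-`5` diagonal form, extended by `0`. [cite: Serre1973, Ch. IV §3.2 Cor. 2] -/
theorem meyer_of_diagonal
    (h : ∀ (c : Fin 5 → ℚ), (∀ i, c i ≠ 0) → (∃ i, c i < 0) → (∃ j, 0 < c j) →
      ∃ x : Fin 5 → ℚ, x ≠ 0 ∧ ∑ i, c i * x i ^ 2 = 0) : meyer := by
  classical
  intro n A hn hA hdet hpos hneg
  obtain ⟨P, Q, c, hPQ, hQP, hD, hc⟩ := exists_congr_diagonal A hA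
  have hc0 := hc hdet
  -- both signs occur among the `cᵢ`
  have htrans : ∀ v : Fin n → ℚ, Matrix.toBilin' A v v = ∑ i, c i * (Q *ᵥ v) i ^ 2 := by
    intro v
    have hv : v = P *ᵥ (Q *ᵥ v) := by rw [Matrix.mulVec_mulVec, hPQ, Matrix.one_mulVec]
    conv_lhs => rw [hv]
    rw [toBilin'_mulVec_mulVec, hD, toBilin'_diagonal_apply]
  obtain ⟨im, him⟩ : ∃ i, c i < 0 := by
    obtain ⟨w, hw⟩ := hneg
    rw [htrans] at hw
    exact exists_neg_of_sum_mul_sq_neg hw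
  obtain ⟨ip, hip⟩ : ∃ i, 0 < c i := by
    obtain ⟨v, hv⟩ := hpos
    rw [htrans] at hv
    obtain ⟨i, hi⟩ := exists_neg_of_sum_mul_sq_neg (c := fun i => -c i) (x := Q *ᵥ v)
      (by simpa [Finset.sum_neg_distrib] using hv)
    exact ⟨i, by linarith⟩
  -- five indices containing `im`, `ip`
  obtain ⟨s, hsub, -, hcard⟩ := Finset.exists_subsuperset_card_eq
    (s := ({im, ip} : Finset (Fin n))) (t := Finset.univ) (n := 5) (Finset.subset_univ _)
    ((Finset.card_le_two).trans (by norm_num)) (by simpa using hn)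
  let e : Fin 5 ↪o Fin n := s.orderEmbOfFin hcard
  have he : Function.Injective e := e.injective
  have hrange : ∀ i, i ∈ s ↔ ∃ k, e k = i := fun i => by
    rw [← Finset.mem_coe, ← Finset.range_orderEmbOfFin s hcard, Set.mem_range]
  obtain ⟨x, hx0, hx⟩ := h (c ∘ e) (fun k => hc0 (e k))
    (by obtain ⟨k, hk⟩ := (hrange im).mp (hsub (by simp)); exact ⟨k, by simp [hk, him]⟩)
    (by obtain ⟨k, hk⟩ := (hrange ip).mp (hsub (by simp)); exact ⟨k, by simp [hk, hip]⟩)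
  -- extend `x` by zero to `Fin n`
  set y : Fin n → ℚ := Function.extend e x 0 with hy
  have hye : ∀ k, y (e k) = x k := fun k => he.extend_apply _ _ k
  have hy0 : ∀ i, i ∉ s → y i = 0 := fun i hi => by
    rw [hy, Function.extend_apply' _ _ _ (fun ⟨k, hk⟩ => hi ((hrange i).mpr ⟨k, hk⟩))]
    rfl
  have hyne : y ≠ 0 := fun h0 => hx0 (funext fun k => by rw [← hye k, h0]; rfl)
  have hysum : ∑ i, c i * y i ^ 2 = 0 := by
    rw [← Finset.sum_subset (Finset.subset_univ (Finset.univ.map e.toEmbedding))]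
    · rw [Finset.sum_map]
      simp only [RelEmbedding.coe_toEmbedding, hye]
      exact hx
    · intro i _ hi
      have : i ∉ s := fun his => hi (by
        obtain ⟨k, hk⟩ := (hrange i).mp his
        exact Finset.mem_map.mpr ⟨k, Finset.mem_univ k, hk⟩)
      rw [hy0 i this]; ring
  refine representsZero_of_congr hQP ⟨y, hyne, ?_⟩
  rw [hD, toBilin'_diagonal_apply, hysum]

/-! ### `RepresentsZero` and Mathlib's `QuadraticMap.Anisotropic` -/

/-- `A` represents zero iff the quadratic form `ᵗv A v` (Mathlib `Matrix.toQuadraticMap'`) is not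
anisotropic — the dictionary with Mathlib's `QuadraticMap.Anisotropic`, for consumers in
`QuadraticForm`/`BilinForm` language. [folklore] -/
theorem representsZero_iff_not_anisotropic {n : ℕ} (A : Matrix (Fin n) (Fin n) ℚ) :
    RepresentsZero A ↔ ¬ (Matrix.toBilin' A).toQuadraticMap.Anisotropic := by
  rw [QuadraticMap.not_anisotropic_iff_exists]
  rfl

end Literature.NumberTheory.QuadraticForms
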